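import Summits.QuantumFields.YangMills.Theorems.BalabanUVNodesK0RecordFormatNamesLemmas3
import Summits.QuantumFields.YangMills.Theorems.BalabanUVNodesK0RecordFormatNamesAx

/-!
# K0⁷ record FORMAT⁺ names — lemma file 4: the faces and joins of the GENERIC Π-layer (§19) and of its block-axial-centred instances `…Ax`
# (names EDITION 11 = [Ax-4], leaf module `BalabanUVNodesK0RecordFormatNamesAx`)

Companion of `…BalabanUVNodesK0RecordFormatNames` §19 (EDITION 10, CRIT-1 g33 (Φ3)) and of the [Ax-4] leaf (EDITION 11).  Kernel-checked
bookkeeping, nothing of Bałaban's asserted; DEFINER seat `ym-nodeO-def-1` gen 34; `--kind proof --supports stmt-QuantumFields-20541 --as helper`.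

* §1 GENERIC faces (`rfl` ∕ `simp only`): `plimOf` along a sequence IS `U3OfKernels.kernelA`; `pvolOf → plimOf` under `PolLimitExists`; `pkOf` at
  the history's own last coupling IS `plimOf`; `pkOf … t 0 1 z = (pℓOf … t z).re`; the (5.42) flow's fields; `betaMerged fam = secondMoment ∘ plimOf fam`.
* §2 GENERIC ON-THE-BOX FACE of def-B's χ-generic β: for `v ∈ ]0, θ₈.γ]^{k+1}`,
  `betaOfRecord₈Tχ F N T χ θ₈ k v = secondMoment (plimOf F (mergedTermFamilyMatT F N T χ θ₈.εbg) θ₈.ρ8 θ₈.bV k v) 0 1` (= of `pkOf` at the last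
  coupling = of `betaFlowOf` along any extending sequence).
* §3 GENERIC JOIN with `B12BetaHolo.PiHoloSource` (`piHoloSource_of_piHoloAtOf`, `…_of_flow`, `abs_flow_beta_le_of_piHoloAtOf`) and the
  TOWER-FREE chain `PiHoloAtOf ⟹ (5.10) on [0, γ] ⟹ |(1.22)-moment| ≤ β′₅.₁₀`; `PiHoloUniformOf … γ r C δ₁ ⟹ |betaMerged| ≤ β′₅.₁₀` on the γ-box ⟹
  for `γ ≤ θ₈.γ` the two-sided box `BetaUpperH β′₅.₁₀ γ (betaOfRecord₈Tχ …) ∧ BetaLowerH (−β′₅.₁₀) γ (betaOfRecord₈Tχ …)`.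
* §4 the §18 RECORD names ARE §19's instances at `(recordTerms F a₀ ε₂₉, θfill.ρ8, θfill.bV)` (`rfl` ×8).
* §5 the [Ax-4] faces: `recordΦfAx` is `recordΦf`'s body with the ONE token `chiβOfRecord₁₃ ↦ chiβOfRecord₁₃Ax` (`rfl`); `recordZeroTermsAx` unfolds to
  typer-1's `ZeroInput.zeroInputMergedTermT` = the SAME step functional `ZeroInput.stepOutT` at zero input; ON THE BOX `]0, ½]^{k+1}` the RE-CENTRED β
  `betaOfRecord₁₃Ax F 2 (thetaFill F a₀ ε₂₉)` IS the (1.22)-moment of `recordPlimAx` ∕ of `recordPkAx` at the last coupling ∕ the value of `recordBetaFlowAx`;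
  **θ-BLINDNESS (`rfl`)** `betaOfRecord₁₃Ax F 2 (theta13OfThm1CCMWZB F 2 j ½ a₀ ε₀ ε₂₉ B₃ B₃' a₀ a₁ 0 0) = betaOfRecord₁₃Ax F 2 (thetaFill F a₀ ε₂₉)`; the join
  and the tower-free β-box over `RecordPiHoloAtAx ∕ RecordPiHoloUniformAx` (stub 2″'s `BetaLowerH ∕ BetaUpperH` pair at the RE-CENTRED β, γ ≤ ½).

HONEST FRAMING.  Helper lemmas about DEF-1's names (count-neutral); no port text is closed here; 27930⁸ ∕ 26648 v4Ax UNSIGNED at filing; stub 2′ OPEN;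
K0⁷ NOT closed (and as vetted choice-centred; RESTATE v2 pre-authorised, not done); NODE O not inhabited; finite 𝕋⁴ at fixed ε — not continuum ∕ OS ∕ Clay;
the Yang–Mills mass gap is NOT proved by any of this.
-/

noncomputable section

open scoped BigOperators Matrix.Norms.L2Operator Topology
open Set Filter

namespace Summit.QuantumFields.YangMills.Theorems.K0RecordFormatNames

open Literature.MathematicalPhysics.QuantumFieldTheory.Balaban1983to89
open Literature.MathematicalPhysics.QuantumFieldTheory.Balaban1983to89.Node00
open Literature.MathematicalPhysics.QuantumFieldTheory.Balaban1983to89.T4Continuum (T4Family)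
open Literature.MathematicalPhysics.QuantumFieldTheory.Balaban1983to89.Step (SFTower SFConsts)
open Literature.MathematicalPhysics.QuantumFieldTheory.Balaban1983to89.B12BetaHolo (PiHoloSource nonempty_piHoloSource)
open Literature.MathematicalPhysics.QuantumFieldTheory.Balaban1983to89.T4OutputRate (Window)
open Literature.MathematicalPhysics.QuantumFieldTheory.Balaban1983to89.Node00.U3OfKernels (kernelA histPrefix)
open Literature.MathematicalPhysics.QuantumFieldTheory.Balaban1983to89.Node00.U3KernelLetters (PolLimitsExistOfRecord₁₃)

variable (F : T4Family)

/-! ## §1  GENERIC faces of the §19 Π-layer -/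

section Generic

variable {𝔄 : Type*} [NormedRing 𝔄] [NormedAlgebra ℝ 𝔄]
variable {V : Type*} [NormedAddCommGroup V] [NormedSpace ℝ V] {ι : Type*} [Fintype ι]
variable (fam : TermFamily1 F 𝔄) (ρ : V →L[ℝ] 𝔄) (bV : Module.Basis ι ℝ V)

/-- Along a coupling sequence the generic limiting kernel IS `kernelA` of the family (`rfl`). [cite: Balaban1987RG1, (1.21) p.264 (bookkeeping)] -/
theorem plimOf_histPrefix_eq_kernelA (w : ℕ → ℝ) (k : ℕ) : plimOf F fam ρ bV k (histPrefix w k) = kernelA F fam ρ bV w k := rfl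

/-- Unfolding `pvolOf` (`rfl`). [cite: Balaban1987RG1, (1.20)–(1.21) p.264 (bookkeeping)] -/
theorem pvolOf_apply (k : ℕ) (v : Fin (k + 1) → ℝ) (K : ℕ) (μ ν : Fin 4) (z : Fin 4 → ℤ) :
    pvolOf F fam ρ bV k v K μ ν z = polWindow F K (k + 1) (fam k v K) ρ bV μ ν z := rfl

/-- **(1.21) for a term family under the existence letter**: the finite-volume kernels converge to `plimOf`. [cite: Balaban1987RG1, (1.21) p.264] -/
theorem tendsto_pvolOf (k : ℕ) (v : Fin (k + 1) → ℝ) (h : PolLimitExists F (k + 1) (fun K => fam k v K) ρ bV) (μ ν : Fin 4) (z : Fin 4 → ℤ) :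
    Tendsto (fun K => pvolOf F fam ρ bV k v K μ ν z) atTop (𝓝 (plimOf F fam ρ bV k v μ ν z)) :=
  tendsto_polLimit F (k + 1) _ _ _ h μ ν z

/-- Unfolding `pkOf` (`rfl`). [cite: Balaban1987RG1, (5.42) p.297 (bookkeeping)] -/
theorem pkOf_apply (k : ℕ) (v : Fin (k + 1) → ℝ) (t : ℝ) : pkOf F fam ρ bV k v t = plimOf F fam ρ bV k (Function.update v (Fin.last k) t) := rfl

/-- At the history's OWN last coupling the generic kernel family returns the limiting kernel of that history. [cite: Balaban1987RG1, (1.21)–(1.22) p.264 (bookkeeping)] -/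
theorem pkOf_last (k : ℕ) (v : Fin (k + 1) → ℝ) : pkOf F fam ρ bV k v (v (Fin.last k)) = plimOf F fam ρ bV k v := by
  simp only [pkOf, Function.update_eq_self]

/-- The generic real kernel's `(0, 1)`-component is the real part of `pℓOf`. [cite: Balaban1987RG1, (1.21) p.264 (bookkeeping)] -/
theorem pkOf_eq_re_pℓOf (k : ℕ) (v : Fin (k + 1) → ℝ) (t : ℝ) (z : Fin 4 → ℤ) :
    pkOf F fam ρ bV k v t 0 1 z = (pℓOf F fam ρ bV k v t z).re := by
  simp only [pℓOf, Complex.ofReal_re]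

/-- The generic (5.42) flow's couplings (`rfl`). [cite: Balaban1987RG1, (0.20) p.256 (bookkeeping)] -/
theorem betaFlowOf_g (w : ℕ → ℝ) : (betaFlowOf F fam ρ bV w).g = w := rfl

/-- The generic (5.42) flow's `β_{k+1}` IS (1.22) of the family's kernel family at the earlier history (`rfl`) — the `beta_eq` field of `PiHoloSource`
for any tower carrying this flow. [cite: Balaban1987RG1, (5.42) p.297, (1.22) p.264] -/
theorem betaFlowOf_beta_succ (w : ℕ → ℝ) (k : ℕ) (t : ℝ) :
    (betaFlowOf F fam ρ bV w).β (k + 1) t = B12Beta.secondMoment (pkOf F fam ρ bV k (FlowStep.prefixOf w k) t) 0 1 := rfl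

/-- **def-B's merged β of a family IS the (1.22)-moment of `plimOf`** (`rfl`). [cite: Balaban1987RG1, (1.22) p.264 (bookkeeping)] -/
theorem betaMerged_eq_secondMoment_plimOf (k : ℕ) (v : Fin (k + 1) → ℝ) :
    betaMerged F fam ρ bV k v = B12Beta.secondMoment (plimOf F fam ρ bV k v) 0 1 := rfl

/-! ## §3a  GENERIC join with `B12BetaHolo.PiHoloSource` -/

section Join

variable {P : Params} {G : Type*} [GaugeGroup G] {Φ 𝒢 : Type*}

/-- **`PiHoloSource` FROM THE GENERIC RECEIPT, FIELDS BY NAME**: `PiHoloAtOf F fam ρ bV k v U c.γ C δ₁`, a tower whose `β_{k+1}` is (5.42) of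
`pkOf F fam ρ bV k v` on `[0, c.γ]`, and `β′₅.₁₀ = betaPrime510 4 C δ₁ ≤ c.β'` give `Nonempty (PiHoloSource T c k)` with `d := 4`, `(μ, ν) := (0, 1)`,
`Pk := pkOf F fam ρ bV k v`. [cite: Balaban1987RG1, (5.10) p.293, (5.42) p.297, p.266 (analytic alternative)] -/
theorem piHoloSource_of_piHoloAtOf {T : SFTower P G Φ 𝒢} {c : SFConsts} {k : ℕ} {v : Fin (k + 1) → ℝ} {U : Set ℂ} {C δ₁ : ℝ}
    (h : PiHoloAtOf F fam ρ bV k v U c.γ C δ₁)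
    (hβ : ∀ t, 0 ≤ t → t ≤ c.γ → T.flow.β (k + 1) t = B12Beta.secondMoment (pkOf F fam ρ bV k v t) 0 1)
    (hle : B12Sec2to5.betaPrime510 4 C δ₁ ≤ c.β') : Nonempty (PiHoloSource T c k) := by
  obtain ⟨hU, hIU, hδ, Pc, hPc, hdec, hre⟩ := h
  exact nonempty_piHoloSource 0 1 (pkOf F fam ρ bV k v) hβ hU hIU Pc hPc hδ hdec hre hle

/-- **… for a tower CARRYING `betaFlowOf F fam ρ bV w` the `beta_eq` premise is automatic.** [cite: Balaban1987RG1, (5.42) p.297] -/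
theorem piHoloSource_of_piHoloAtOf_of_flow {T : SFTower P G Φ 𝒢} {c : SFConsts} {k : ℕ} (w : ℕ → ℝ)
    (hT : T.flow = betaFlowOf F fam ρ bV w) {U : Set ℂ} {C δ₁ : ℝ}
    (h : PiHoloAtOf F fam ρ bV k (FlowStep.prefixOf w k) U c.γ C δ₁) (hle : B12Sec2to5.betaPrime510 4 C δ₁ ≤ c.β') :
    Nonempty (PiHoloSource T c k) :=
  piHoloSource_of_piHoloAtOf F fam ρ bV h (fun t _ _ => by rw [hT]; rfl) hle

/-- **Hence the β-BOUND of the Theorem-3 step for the family** (`PiHoloSource.betaBound`). [cite: Balaban1987RG1, p.264 (Thm 3 β-clause «uniformly bounded»)] -/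
theorem abs_flow_beta_le_of_piHoloAtOf {T : SFTower P G Φ 𝒢} {c : SFConsts} {k : ℕ} {v : Fin (k + 1) → ℝ} {U : Set ℂ} {C δ₁ : ℝ}
    (h : PiHoloAtOf F fam ρ bV k v U c.γ C δ₁)
    (hβ : ∀ t, 0 ≤ t → t ≤ c.γ → T.flow.β (k + 1) t = B12Beta.secondMoment (pkOf F fam ρ bV k v t) 0 1)
    (hle : B12Sec2to5.betaPrime510 4 C δ₁ ≤ c.β') : ∀ t ∈ Set.Icc (0 : ℝ) c.γ, |T.flow.β (k + 1) t| ≤ c.β' := by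
  obtain ⟨S⟩ := piHoloSource_of_piHoloAtOf F fam ρ bV h hβ hle
  exact S.betaBound

end Join

/-! ## §3b  GENERIC tower-free chain: (5.10) for the real kernel, the (1.22)-bound, `|betaMerged| ≤ β′₅.₁₀` on the box -/

/-- **(5.10) ON `[0, γ]` FOR THE FAMILY's REAL KERNEL** from the generic receipt (`|Re Pc| ≤ ‖Pc‖`). [cite: Balaban1987RG1, (5.10) p.293] -/
theorem decay510_pkOf_of_piHoloAtOf {k : ℕ} {v : Fin (k + 1) → ℝ} {U : Set ℂ} {γ C δ₁ : ℝ}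
    (h : PiHoloAtOf F fam ρ bV k v U γ C δ₁) {t : ℝ} (ht : t ∈ Set.Icc (0 : ℝ) γ) :
    B12Sec2to5.Decay510 (pkOf F fam ρ bV k v t 0 1) C δ₁ := by
  obtain ⟨-, hIU, -, Pc, -, hdec, hre⟩ := h
  intro z
  rw [hre z t ht]
  exact (Complex.abs_re_le_norm _).trans (hdec z t (hIU t ht))

/-- **THE (1.22)-BOUND FOR THE FAMILY, tower-free**: `|Σ_x Π^{(k+1)}_{01}(t, x) x₀ x₁| ≤ β′₅.₁₀` on `[0, γ]`. [cite: Balaban1987RG1, p.264 (β-clause), (5.10) p.293, (5.42) p.297] -/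
theorem abs_secondMoment_pkOf_le {k : ℕ} {v : Fin (k + 1) → ℝ} {U : Set ℂ} {γ C δ₁ : ℝ}
    (h : PiHoloAtOf F fam ρ bV k v U γ C δ₁) {t : ℝ} (ht : t ∈ Set.Icc (0 : ℝ) γ) :
    |B12Beta.secondMoment (pkOf F fam ρ bV k v t) 0 1| ≤ B12Sec2to5.betaPrime510 4 C δ₁ :=
  (B12Sec2to5.secondMoment_abs_le_of_decay510 h.2.2.1 (decay510_pkOf_of_piHoloAtOf F fam ρ bV h ht)).2

/-- **UNIFORM Π-HOLOMORPHY OF A FAMILY BOUNDS ITS MERGED β ON THE BOX**: `|betaMerged F fam ρ bV k v| ≤ β′₅.₁₀` for `v ∈ ]0, γ]^{k+1}`.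
[cite: Balaban1987RG1, p.263–264 (Thm 3, «uniformly bounded»), (5.10) p.293, (1.22) p.264] -/
theorem abs_betaMerged_le_of_piHoloUniformOf {γ r C δ₁ : ℝ} (h : PiHoloUniformOf F fam ρ bV γ r C δ₁) {k : ℕ} {v : Fin (k + 1) → ℝ}
    (hv : v ∈ FlowStep.Box γ k) : |betaMerged F fam ρ bV k v| ≤ B12Sec2to5.betaPrime510 4 C δ₁ := by
  have hlast : v (Fin.last k) ∈ Set.Icc (0 : ℝ) γ :=
    ⟨(FlowStep.mem_box.1 hv (Fin.last k)).1.le, (FlowStep.mem_box.1 hv (Fin.last k)).2⟩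
  rw [betaMerged_eq_secondMoment_plimOf, ← pkOf_last]
  exact abs_secondMoment_pkOf_le F fam ρ bV (h.2 k v hv) hlast

end Generic

/-! ## §2  GENERIC ON-THE-BOX FACE of def-B's χ-generic β `betaOfRecord₈Tχ`, and the Stage-8 β-box from uniform Π-holomorphy -/

section Stage8

variable {N : ℕ} [NeZero N]

/-- **Unfolding `betaOfRecord₈Tχ`** (`rfl`): the box convention over the merged β of `mergedTermFamilyMatT F N T χ θ₈.εbg`. [cite: Balaban1987RG1, (1.22) p.264, (2.12)–(2.14) p.268] -/
theorem betaOfRecord₈Tχ_eq (T : Transport F N) (χ : (K : ℕ) → (ℕ → ℝ) → (k : ℕ) → Density (F.P K) k (SU N)) (θ₈ : Stage8Params F N)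
    (k : ℕ) (v : Fin (k + 1) → ℝ) :
    betaOfRecord₈Tχ F N T χ θ₈ k v =
      (letI := θ₈.instVβ₁; letI := θ₈.instVβ₂; letI := θ₈.instιβ
       betaOfMerged (betaMerged F (mergedTermFamilyMatT F N T χ θ₈.εbg) θ₈.ρ8 θ₈.bV)
        (beta0OfMerged (betaMerged F (mergedTermFamilyMatT F N T χ θ₈.εbg) θ₈.ρ8 θ₈.bV) θ₈.v₀) θ₈.γ k v) := rfl

/-- **GENERIC ON-THE-BOX FACE**: for `v ∈ ]0, θ₈.γ]^{k+1}`, def-B's χ-generic β IS the (1.22)-moment of §19's `plimOf` of the merged family.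
[cite: Balaban1987RG1, (1.22) p.264] -/
theorem betaOfRecord₈Tχ_of_mem_box (T : Transport F N) (χ : (K : ℕ) → (ℕ → ℝ) → (k : ℕ) → Density (F.P K) k (SU N)) (θ₈ : Stage8Params F N)
    {k : ℕ} {v : Fin (k + 1) → ℝ} (hv : v ∈ FlowStep.Box θ₈.γ k) :
    betaOfRecord₈Tχ F N T χ θ₈ k v =
      (letI := θ₈.instVβ₁; letI := θ₈.instVβ₂; letI := θ₈.instιβ
       B12Beta.secondMoment (plimOf F (mergedTermFamilyMatT F N T χ θ₈.εbg) θ₈.ρ8 θ₈.bV k v) 0 1) := by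
  rw [betaOfRecord₈Tχ_eq, betaOfMerged_of_mem _ _ _ hv]
  rfl

/-- … equivalently of `pkOf` at the history's last coupling. [cite: Balaban1987RG1, (5.42) p.297] -/
theorem betaOfRecord₈Tχ_eq_secondMoment_pkOf (T : Transport F N) (χ : (K : ℕ) → (ℕ → ℝ) → (k : ℕ) → Density (F.P K) k (SU N))
    (θ₈ : Stage8Params F N) {k : ℕ} {v : Fin (k + 1) → ℝ} (hv : v ∈ FlowStep.Box θ₈.γ k) :
    betaOfRecord₈Tχ F N T χ θ₈ k v =
      (letI := θ₈.instVβ₁; letI := θ₈.instVβ₂; letI := θ₈.instιβ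
       B12Beta.secondMoment (pkOf F (mergedTermFamilyMatT F N T χ θ₈.εbg) θ₈.ρ8 θ₈.bV k v (v (Fin.last k))) 0 1) := by
  letI := θ₈.instVβ₁; letI := θ₈.instVβ₂; letI := θ₈.instιβ
  rw [pkOf_last]
  exact betaOfRecord₈Tχ_of_mem_box F T χ θ₈ hv

/-- … equivalently the value of `betaFlowOf` along any sequence `w` extending the history. [cite: Balaban1987RG1, (5.42) p.297, (0.20) p.256] -/
theorem betaOfRecord₈Tχ_eq_betaFlowOf (T : Transport F N) (χ : (K : ℕ) → (ℕ → ℝ) → (k : ℕ) → Density (F.P K) k (SU N))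
    (θ₈ : Stage8Params F N) (w : ℕ → ℝ) {k : ℕ} (hv : FlowStep.prefixOf w k ∈ FlowStep.Box θ₈.γ k) :
    betaOfRecord₈Tχ F N T χ θ₈ k (FlowStep.prefixOf w k) =
      (letI := θ₈.instVβ₁; letI := θ₈.instVβ₂; letI := θ₈.instιβ
       (betaFlowOf F (mergedTermFamilyMatT F N T χ θ₈.εbg) θ₈.ρ8 θ₈.bV w).β (k + 1) (w k)) :=
  betaOfRecord₈Tχ_eq_secondMoment_pkOf F T χ θ₈ hv

/-- **THE STAGE-8 β-BOX FROM UNIFORM Π-HOLOMORPHY OF THE MERGED FAMILY** (the shape stub 2′ ∕ 2″ consumes, χ-generic): for `γ ≤ θ₈.γ`,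
`BetaUpperH β′₅.₁₀ γ (betaOfRecord₈Tχ F N T χ θ₈) ∧ BetaLowerH (−β′₅.₁₀) γ (betaOfRecord₈Tχ F N T χ θ₈)`, `β′₅.₁₀ = betaPrime510 4 C δ₁`.
[cite: Balaban1987RG1, p.264 (Thm 3 β-clause), (5.10) p.293, (1.22) p.264] -/
theorem betaBox_betaOfRecord₈Tχ_of_piHoloUniformOf (T : Transport F N) (χ : (K : ℕ) → (ℕ → ℝ) → (k : ℕ) → Density (F.P K) k (SU N))
    (θ₈ : Stage8Params F N) {γ r C δ₁ : ℝ} (hγ : γ ≤ θ₈.γ)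
    (h : letI := θ₈.instVβ₁; letI := θ₈.instVβ₂; letI := θ₈.instιβ
      PiHoloUniformOf F (mergedTermFamilyMatT F N T χ θ₈.εbg) θ₈.ρ8 θ₈.bV γ r C δ₁) :
    FlowStep.BetaUpperH (B12Sec2to5.betaPrime510 4 C δ₁) γ (betaOfRecord₈Tχ F N T χ θ₈) ∧
      FlowStep.BetaLowerH (-B12Sec2to5.betaPrime510 4 C δ₁) γ (betaOfRecord₈Tχ F N T χ θ₈) := by
  letI := θ₈.instVβ₁; letI := θ₈.instVβ₂; letI := θ₈.instιβ
  have key : ∀ (k : ℕ) (v : Fin (k + 1) → ℝ), v ∈ FlowStep.Box γ k →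
      |betaOfRecord₈Tχ F N T χ θ₈ k v| ≤ B12Sec2to5.betaPrime510 4 C δ₁ := by
    intro k v hv
    rw [betaOfRecord₈Tχ_of_mem_box F T χ θ₈ (box_mono hγ hv), ← betaMerged_eq_secondMoment_plimOf]
    exact abs_betaMerged_le_of_piHoloUniformOf F _ θ₈.ρ8 θ₈.bV h hv
  exact ⟨fun k v hv => (le_abs_self _).trans (key k v hv),
    fun k v hv => (neg_le_neg (key k v hv)).trans (neg_abs_le _)⟩

end Stage8

/-! ## §4  The §18 RECORD names ARE §19's instances at `(recordTerms F a₀ ε₂₉, θfill.ρ8, θfill.bV)` (`rfl`) -/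

variable (a₀ ε₂₉ : ℝ)

/-- `recordΦf = ΦfOf F (recordTerms …) θfill.ρ8` (`rfl`). [cite: Balaban1987RG1, (1.6) p.261, (1.20) p.264 (bookkeeping)] -/
theorem recordΦf_eq_ΦfOf (k : ℕ) (v : Fin (k + 1) → ℝ) (K : ℕ) :
    recordΦf F a₀ ε₂₉ k v K =
      (letI θ := thetaFill F a₀ ε₂₉
       letI := θ.instVβ₁; letI := θ.instVβ₂
       ΦfOf F (recordTerms F a₀ ε₂₉) θ.ρ8 k v K) := rfl

/-- `recordPvol = pvolOf …` (`rfl`). [cite: Balaban1987RG1, (1.20)–(1.21) p.264 (bookkeeping)] -/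
theorem recordPvol_eq_pvolOf (k : ℕ) (v : Fin (k + 1) → ℝ) (K : ℕ) :
    recordPvol F a₀ ε₂₉ k v K =
      (letI θ := thetaFill F a₀ ε₂₉
       letI := θ.instVβ₁; letI := θ.instVβ₂; letI := θ.instιβ
       pvolOf F (recordTerms F a₀ ε₂₉) θ.ρ8 θ.bV k v K) := rfl

/-- `recordPlim = plimOf …` (`rfl`). [cite: Balaban1987RG1, (1.21) p.264 (bookkeeping)] -/
theorem recordPlim_eq_plimOf (k : ℕ) (v : Fin (k + 1) → ℝ) :
    recordPlim F a₀ ε₂₉ k v =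
      (letI θ := thetaFill F a₀ ε₂₉
       letI := θ.instVβ₁; letI := θ.instVβ₂; letI := θ.instιβ
       plimOf F (recordTerms F a₀ ε₂₉) θ.ρ8 θ.bV k v) := rfl

/-- `recordPk = pkOf …` (`rfl`). [cite: Balaban1987RG1, (5.42) p.297 (bookkeeping)] -/
theorem recordPk_eq_pkOf (k : ℕ) (v : Fin (k + 1) → ℝ) :
    recordPk F a₀ ε₂₉ k v =
      (letI θ := thetaFill F a₀ ε₂₉
       letI := θ.instVβ₁; letI := θ.instVβ₂; letI := θ.instιβ
       pkOf F (recordTerms F a₀ ε₂₉) θ.ρ8 θ.bV k v) := rfl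

/-- `recordPℓ = pℓOf …` (`rfl`). [cite: Balaban1987RG1, (1.21)–(1.22) p.264 (bookkeeping)] -/
theorem recordPℓ_eq_pℓOf (k : ℕ) (v : Fin (k + 1) → ℝ) :
    recordPℓ F a₀ ε₂₉ k v =
      (letI θ := thetaFill F a₀ ε₂₉
       letI := θ.instVβ₁; letI := θ.instVβ₂; letI := θ.instιβ
       pℓOf F (recordTerms F a₀ ε₂₉) θ.ρ8 θ.bV k v) := rfl

/-- `(recordBetaFlow … w).β = (betaFlowOf … w).β` at every step (`rfl`, by cases on the step). [cite: Balaban1987RG1, (5.42) p.297 (bookkeeping)] -/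
theorem recordBetaFlow_beta_eq_betaFlowOf (w : ℕ → ℝ) (j : ℕ) (t : ℝ) :
    (recordBetaFlow F a₀ ε₂₉ w).β j t =
      (letI θ := thetaFill F a₀ ε₂₉
       letI := θ.instVβ₁; letI := θ.instVβ₂; letI := θ.instιβ
       (betaFlowOf F (recordTerms F a₀ ε₂₉) θ.ρ8 θ.bV w).β j t) := by
  cases j <;> rfl

/-- `RecordPiHoloAt ↔ PiHoloAtOf …` (`Iff.rfl`). [cite: Balaban1987RG1, (5.10) p.293 (bookkeeping)] -/
theorem recordPiHoloAt_iff_piHoloAtOf (k : ℕ) (v : Fin (k + 1) → ℝ) (U : Set ℂ) (γ C δ₁ : ℝ) :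
    RecordPiHoloAt F a₀ ε₂₉ k v U γ C δ₁ ↔
      (letI θ := thetaFill F a₀ ε₂₉
       letI := θ.instVβ₁; letI := θ.instVβ₂; letI := θ.instιβ
       PiHoloAtOf F (recordTerms F a₀ ε₂₉) θ.ρ8 θ.bV k v U γ C δ₁) := Iff.rfl

/-- `RecordPiHoloUniform ↔ PiHoloUniformOf …` (`Iff.rfl`). [cite: Balaban1987RG1, p.263–264 (bookkeeping)] -/
theorem recordPiHoloUniform_iff_piHoloUniformOf (γ r C δ₁ : ℝ) :
    RecordPiHoloUniform F a₀ ε₂₉ γ r C δ₁ ↔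
      (letI θ := thetaFill F a₀ ε₂₉
       letI := θ.instVβ₁; letI := θ.instVβ₂; letI := θ.instιβ
       PiHoloUniformOf F (recordTerms F a₀ ε₂₉) θ.ρ8 θ.bV γ r C δ₁) := Iff.rfl

/-! ## §5  The [Ax-4] faces: one-token swap, zero input, on the box, θ-blindness, join, β-box -/

/-- **`recordΦfAx` IS `recordΦf`'s BODY WITH THE ONE TOKEN `chiβOfRecord₁₃ ↦ chiβOfRecord₁₃Ax`** (`rfl`; compare `recordΦf_eq_expChart_recordTerms`).
[cite: Balaban1987RG1, (1.6) p.261, (1.20) p.264, (2.9) p.266 (bookkeeping)] -/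
theorem recordΦfAx_eq_expChart (k : ℕ) (v : Fin (k + 1) → ℝ) (K : ℕ) (B : recordW F a₀ ε₂₉ k K) :
    recordΦfAx F a₀ ε₂₉ k v K B =
      (letI θ := thetaFill F a₀ ε₂₉
       letI := θ.instVβ₁; letI := θ.instVβ₂
       ((B12PolarizationTensor120.expChart
          (mergedTermFamilyMatT F 2 (TβOfRecord₁₃ F 2) (chiβOfRecord₁₃Ax F 2 θ) θ.εbg k v K) θ.ρ8 B : ℝ) : ℂ)) := rfl

/-- **`recordΦzAx` unfolded** (`rfl`): the exp-chart of the ZERO-INPUT merged family over the Ax cut-off. [cite: Balaban1987RG1, (1.6) p.261, (1.20) p.264; Balaban1988RG2Cluster, p.21 (bookkeeping)] -/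
theorem recordΦzAx_eq_expChart (k : ℕ) (v : Fin (k + 1) → ℝ) (K : ℕ) (B : recordW F a₀ ε₂₉ k K) :
    recordΦzAx F a₀ ε₂₉ k v K B =
      (letI θ := thetaFill F a₀ ε₂₉
       letI := θ.instVβ₁; letI := θ.instVβ₂
       ((B12PolarizationTensor120.expChart
          (ZeroInput.zeroInputMergedTermFamilyMatT F 2 (TβOfRecord₁₃ F 2) (chiβOfRecord₁₃Ax F 2 θ) θ.εbg k v K) θ.ρ8 B : ℝ) : ℂ)) := rfl

/-- The Ax term family re-centred: `recordTermsAx` reads `[Ax-2]`'s `chiFixed29Ax θfill.ν θfill.ε₂₉` (`rfl`). [cite: Balaban1987RG1, (2.9) p.266 (bookkeeping)] -/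
theorem recordTermsAx_eq :
    recordTermsAx F a₀ ε₂₉ =
      mergedTermFamilyMatT F 2 (TβOfRecord₁₃ F 2) (chiFixed29Ax F 2 (thetaFill F a₀ ε₂₉).ν (thetaFill F a₀ ε₂₉).ε₂₉) (thetaFill F a₀ ε₂₉).εbg := rfl

/-- **The zero-input family IS the SAME step functional at zero input** (typer-1's `ZeroInput.zeroInputMergedTermT`, pointwise `rfl`). [cite: Balaban1987RG1, (1.6) p.261 (bookkeeping)] -/
theorem recordZeroTermsAx_apply (k : ℕ) (v : Fin (k + 1) → ℝ) (K : ℕ)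
    (W : Fin (F.P K).d → Site (F.P K) (k + 1) → Matrix (Fin 2) (Fin 2) ℂ) :
    recordZeroTermsAx F a₀ ε₂₉ k v K W =
      ZeroInput.zeroInputMergedTermT F 2 (TβOfRecord₁₃ F 2) (chiβOfRecord₁₃Ax F 2 (thetaFill F a₀ ε₂₉)) (thetaFill F a₀ ε₂₉).εbg K
        (T4FlagMemory.extd v) k (readField F 2 (suOfMat 2) W) := rfl

/-- **Unfolding the RE-CENTRED β of record at `thetaFill`** (`rfl`): the box convention over the Ax family, window `½`. [cite: Balaban1987RG1, (1.22) p.264, (2.12)–(2.14) p.268] -/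
theorem betaOfRecord₁₃Ax_thetaFill_eq (k : ℕ) (v : Fin (k + 1) → ℝ) :
    betaOfRecord₁₃Ax F 2 (thetaFill F a₀ ε₂₉) k v =
      (letI θ := thetaFill F a₀ ε₂₉
       letI := θ.instVβ₁; letI := θ.instVβ₂; letI := θ.instιβ
       betaOfMerged (betaMerged F (recordTermsAx F a₀ ε₂₉) θ.ρ8 θ.bV)
        (beta0OfMerged (betaMerged F (recordTermsAx F a₀ ε₂₉) θ.ρ8 θ.bV) θ.v₀) (1 / 2) k v) := rfl

/-- **ON THE BOX the RE-CENTRED β of record IS the (1.22)-moment of `recordPlimAx`.** [cite: Balaban1987RG1, (1.22) p.264] -/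
theorem betaOfRecord₁₃Ax_thetaFill_of_mem_box {k : ℕ} {v : Fin (k + 1) → ℝ} (hv : v ∈ FlowStep.Box (1 / 2) k) :
    betaOfRecord₁₃Ax F 2 (thetaFill F a₀ ε₂₉) k v = B12Beta.secondMoment (recordPlimAx F a₀ ε₂₉ k v) 0 1 := by
  rw [betaOfRecord₁₃Ax_thetaFill_eq, betaOfMerged_of_mem _ _ _ hv]
  rfl

/-- … equivalently of `recordPkAx` at the history's last coupling. [cite: Balaban1987RG1, (5.42) p.297] -/
theorem betaOfRecord₁₃Ax_thetaFill_eq_secondMoment_recordPkAx {k : ℕ} {v : Fin (k + 1) → ℝ} (hv : v ∈ FlowStep.Box (1 / 2) k) :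
    betaOfRecord₁₃Ax F 2 (thetaFill F a₀ ε₂₉) k v = B12Beta.secondMoment (recordPkAx F a₀ ε₂₉ k v (v (Fin.last k))) 0 1 := by
  letI θ := thetaFill F a₀ ε₂₉
  letI := θ.instVβ₁; letI := θ.instVβ₂; letI := θ.instιβ
  rw [betaOfRecord₁₃Ax_thetaFill_of_mem_box F a₀ ε₂₉ hv]
  show _ = B12Beta.secondMoment (pkOf F (recordTermsAx F a₀ ε₂₉) θ.ρ8 θ.bV k v (v (Fin.last k))) 0 1
  rw [pkOf_last]
  rfl

/-- … equivalently the value of `recordBetaFlowAx` along any sequence extending the history. [cite: Balaban1987RG1, (5.42) p.297, (0.20) p.256] -/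
theorem betaOfRecord₁₃Ax_thetaFill_eq_recordBetaFlowAx (w : ℕ → ℝ) {k : ℕ} (hv : FlowStep.prefixOf w k ∈ FlowStep.Box (1 / 2) k) :
    betaOfRecord₁₃Ax F 2 (thetaFill F a₀ ε₂₉) k (FlowStep.prefixOf w k) = (recordBetaFlowAx F a₀ ε₂₉ w).β (k + 1) (w k) :=
  betaOfRecord₁₃Ax_thetaFill_eq_secondMoment_recordPkAx F a₀ ε₂₉ hv

/-- **θ-BLINDNESS OF THE RE-CENTRED β (`rfl`)**: at stub 2′'s witness `theta13OfThm1CCMWZB F 2 j ½ a₀ ε₀ ε₂₉ B₃ B₃' a₀ a₁ 0 0` it IS the re-centred β at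
`thetaFill F a₀ ε₂₉` — the letters `j, ε₀, B₃, B₃', a₁` are not read by β. [cite: Balaban1987RG1, (1.20)–(1.22) p.264 (bookkeeping)] -/
theorem betaOfRecord₁₃Ax_thm1Witness_eq_thetaFill (j : ℕ) (ε₀ B₃ B₃' a₁ : ℝ) :
    betaOfRecord₁₃Ax F 2 (theta13OfThm1CCMWZB F 2 j (1 / 2) a₀ ε₀ ε₂₉ B₃ B₃' a₀ a₁ (fun _ _ => 0) (fun _ _ => 0)) =
      betaOfRecord₁₃Ax F 2 (thetaFill F a₀ ε₂₉) := rfl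

/-- (5.42) of record over the Ax cut-off, `β_{k+1}` field (`rfl`). [cite: Balaban1987RG1, (5.42) p.297 (bookkeeping)] -/
theorem recordBetaFlowAx_beta_succ (w : ℕ → ℝ) (k : ℕ) (t : ℝ) :
    (recordBetaFlowAx F a₀ ε₂₉ w).β (k + 1) t = B12Beta.secondMoment (recordPkAx F a₀ ε₂₉ k (FlowStep.prefixOf w k) t) 0 1 := rfl

section JoinAx

variable {P : Params} {G : Type*} [GaugeGroup G] {Φ 𝒢 : Type*}

/-- **`PiHoloSource` AT THE RE-CENTRED RECORD, FIELDS BY NAME** (`Pk := recordPkAx F a₀ ε₂₉ k v`). [cite: Balaban1987RG1, (5.10) p.293, (5.42) p.297, p.266 (analytic alternative)] -/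
theorem piHoloSource_of_recordPiHoloAtAx {T : SFTower P G Φ 𝒢} {c : SFConsts} {k : ℕ} {v : Fin (k + 1) → ℝ} {U : Set ℂ} {C δ₁ : ℝ}
    (h : RecordPiHoloAtAx F a₀ ε₂₉ k v U c.γ C δ₁)
    (hβ : ∀ t, 0 ≤ t → t ≤ c.γ → T.flow.β (k + 1) t = B12Beta.secondMoment (recordPkAx F a₀ ε₂₉ k v t) 0 1)
    (hle : B12Sec2to5.betaPrime510 4 C δ₁ ≤ c.β') : Nonempty (PiHoloSource T c k) :=
  letI θ := thetaFill F a₀ ε₂₉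
  letI := θ.instVβ₁; letI := θ.instVβ₂; letI := θ.instιβ
  piHoloSource_of_piHoloAtOf F (recordTermsAx F a₀ ε₂₉) θ.ρ8 θ.bV h hβ hle

/-- **… for a tower CARRYING `recordBetaFlowAx F a₀ ε₂₉ w` the `beta_eq` premise is automatic.** [cite: Balaban1987RG1, (5.42) p.297] -/
theorem piHoloSource_of_recordPiHoloAtAx_of_flow {T : SFTower P G Φ 𝒢} {c : SFConsts} {k : ℕ} (w : ℕ → ℝ)
    (hT : T.flow = recordBetaFlowAx F a₀ ε₂₉ w) {U : Set ℂ} {C δ₁ : ℝ}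
    (h : RecordPiHoloAtAx F a₀ ε₂₉ k (FlowStep.prefixOf w k) U c.γ C δ₁) (hle : B12Sec2to5.betaPrime510 4 C δ₁ ≤ c.β') :
    Nonempty (PiHoloSource T c k) :=
  piHoloSource_of_recordPiHoloAtAx F a₀ ε₂₉ h (fun t _ _ => by rw [hT]; rfl) hle

end JoinAx

/-- **(5.10) ON `[0, γ]` FOR THE RE-CENTRED RECORD's REAL KERNEL.** [cite: Balaban1987RG1, (5.10) p.293] -/
theorem decay510_recordPkAx_of_recordPiHoloAtAx {k : ℕ} {v : Fin (k + 1) → ℝ} {U : Set ℂ} {γ C δ₁ : ℝ}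
    (h : RecordPiHoloAtAx F a₀ ε₂₉ k v U γ C δ₁) {t : ℝ} (ht : t ∈ Set.Icc (0 : ℝ) γ) :
    B12Sec2to5.Decay510 (recordPkAx F a₀ ε₂₉ k v t 0 1) C δ₁ :=
  letI θ := thetaFill F a₀ ε₂₉
  letI := θ.instVβ₁; letI := θ.instVβ₂; letI := θ.instιβ
  decay510_pkOf_of_piHoloAtOf F (recordTermsAx F a₀ ε₂₉) θ.ρ8 θ.bV h ht

/-- **THE β-BOX OF THE RE-CENTRED RECORD FROM UNIFORM Π-HOLOMORPHY** (the two conjuncts at `thetaFill`): for `γ ≤ ½`,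
`BetaUpperH β′₅.₁₀ γ (betaOfRecord₁₃Ax F 2 (thetaFill F a₀ ε₂₉)) ∧ BetaLowerH (−β′₅.₁₀) γ (betaOfRecord₁₃Ax F 2 (thetaFill F a₀ ε₂₉))`.
[cite: Balaban1987RG1, p.264 (Thm 3 β-clause), (5.10) p.293, (1.22) p.264] -/
theorem betaBox_thetaFill_of_recordPiHoloUniformAx {γ r C δ₁ : ℝ} (hγ : γ ≤ 1 / 2) (h : RecordPiHoloUniformAx F a₀ ε₂₉ γ r C δ₁) :
    FlowStep.BetaUpperH (B12Sec2to5.betaPrime510 4 C δ₁) γ (betaOfRecord₁₃Ax F 2 (thetaFill F a₀ ε₂₉)) ∧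
      FlowStep.BetaLowerH (-B12Sec2to5.betaPrime510 4 C δ₁) γ (betaOfRecord₁₃Ax F 2 (thetaFill F a₀ ε₂₉)) :=
  betaBox_betaOfRecord₈Tχ_of_piHoloUniformOf F (TβOfRecord₁₃ F 2) (chiβOfRecord₁₃Ax F 2 (thetaFill F a₀ ε₂₉))
    (thetaFill F a₀ ε₂₉).toStage8Params hγ h

/-- **… AND AT STUB 2′'s OWN WITNESS** (θ-blindness): the same box for `betaOfRecord₁₃Ax F 2 (theta13OfThm1CCMWZB F 2 j ½ a₀ ε₀ ε₂₉ B₃ B₃' a₀ a₁ 0 0)` — the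
`BetaLowerH ∕ BetaUpperH` pair of the re-centred stub at `γ₀ := γ`, `β' := β′₅.₁₀`. [cite: Balaban1987RG1, p.264 (Thm 3 β-clause), (5.10) p.293] -/
theorem betaBox_thm1Witness_of_recordPiHoloUniformAx {γ r C δ₁ : ℝ} (hγ : γ ≤ 1 / 2) (h : RecordPiHoloUniformAx F a₀ ε₂₉ γ r C δ₁)
    (j : ℕ) (ε₀ B₃ B₃' a₁ : ℝ) :
    FlowStep.BetaLowerH (-B12Sec2to5.betaPrime510 4 C δ₁) γ
        (betaOfRecord₁₃Ax F 2 (theta13OfThm1CCMWZB F 2 j (1 / 2) a₀ ε₀ ε₂₉ B₃ B₃' a₀ a₁ (fun _ _ => 0) (fun _ _ => 0))) ∧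
      FlowStep.BetaUpperH (B12Sec2to5.betaPrime510 4 C δ₁) γ
        (betaOfRecord₁₃Ax F 2 (theta13OfThm1CCMWZB F 2 j (1 / 2) a₀ ε₀ ε₂₉ B₃ B₃' a₀ a₁ (fun _ _ => 0) (fun _ _ => 0))) := by
  rw [betaOfRecord₁₃Ax_thm1Witness_eq_thetaFill]
  exact ⟨(betaBox_thetaFill_of_recordPiHoloUniformAx F a₀ ε₂₉ hγ h).2, (betaBox_thetaFill_of_recordPiHoloUniformAx F a₀ ε₂₉ hγ h).1⟩

end Summit.QuantumFields.YangMills.Theorems.K0RecordFormatNames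

end
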